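import Mathlib
import Literature.NumberTheory.Transcendental.KZCalculusProofs
import Literature.NumberTheory.Transcendental.KZLogCalculusProofs
import Literature.NumberTheory.Transcendental.KZSemiCanonicalReductionProofs
import Literature.NumberTheory.Transcendental.KZGroundingRelations
import Literature.NumberTheory.Transcendental.KZSubcalculusInvariants
import Literature.NumberTheory.Transcendental.KZDilationMove

/-!
# OffTetraSectorKernel (stmt-KontsevichZagierPeriods-10557), line odd-hyperbolic-ladder: stub stub_affineOrbit

THE EUCLIDEAN AFFINE SECTOR CLOSES OUTRIGHT, in every dimension `d`. Let `B ⊆ ℝᵈ` be ONE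
`ℚ`-semialgebraic body of finite volume, `Φᵢ x = Aᵢ x + bᵢ` (`i < k`) real-algebraic affine maps with
`det Aᵢ ≠ 0`, `rᵢ` integral representations with domain `Φᵢ '' B` and integrand `1` there, and
`mᵢ ∈ ℤ` with `Σ mᵢ · value rᵢ = 0`. Then `Σ mᵢ [rᵢ] ∈ KZ.relations`.

Proof (Kontsevich–Zagier's rules (1b) and (2) only).
* Rule (2) with the affine map `Φᵢ` (constant derivative `Lᵢ = toLin' Aᵢ`, Jacobian `|det Aᵢ|`,
  injective since `det Aᵢ ≠ 0`, `ℚ`-semialgebraic since its coordinates are real-affine with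
  real-algebraic coefficients) gives `[Sᵢ] − [rᵢ] ∈ changeOfVariablesRel`, where
  `Sᵢ = [B, |det Aᵢ|]` is the representation on the COMMON domain `B` with the constant
  real-algebraic integrand `cᵢ = |det Aᵢ|` (`aff_orbit_of_sub_of_mem_changeOfVariablesRel`).
* Soundness of the moves: `value rᵢ = value Sᵢ = cᵢ · vol B`, so the hypothesis reads
  `(Σ mᵢ cᵢ) · vol B = 0`.
* The representation `T = [B, Σ mᵢ cᵢ]` is a relation: either `vol B = 0` (null domain) or
  `Σ mᵢ cᵢ = 0` (zero integrand).
* Iterated integrand additivity (rule (1b)) on the common domain `B`, together with the integer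
  scaling bookkeeping `[σ, k f] ≡ k • [σ, f]` (`k ∈ ℤ`, again rule (1b)), gives
  `[T] − Σ mᵢ • [Sᵢ] ∈ relations` (`aff_orbit_of_sub_sum_zsmul_mem_relations`).
* Bookkeeping in the free abelian group.

The hyperbolic rungs of the ladder need Möbius maps and the non-constant density `t^{-(n+1)}`; here
everything is affine with constant Jacobian, and the Dehn invariant of Hilbert's third problem is
invisible to rules (1b) + (2).

References: M. Kontsevich, D. Zagier, *Periods* (2001), §1.2, rules (1), (2); J. Bochnak, M. Coste,
M.-F. Roy, *Real Algebraic Geometry* (1998), Prop. 2.2.6.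
-/

noncomputable section

open Set MeasureTheory
open Literature.NumberTheory.Transcendental

namespace Summit.KontsevichZagierPeriods.HyperbolicBloch.OffTetraSectorKernel

/-! ### Integer scaling and `ℤ`-combinations on a common domain (rule (1b)) -/

/-- **Integer scaling is integrand additivity**, `ℤ`-version: for `k ∈ ℤ`, `[σ, k f] − k • [σ, f]`
is a relation (the case `k ∈ ℕ` is `KZ.IntegralRep.of_constMul_nat_sub_nsmul_mem_relations`; for
`k = -(j+1)` add `[σ, -(j+1) f] + [σ, (j+1) f] ∈ relations`).
[cite: KontsevichZagier2001, §1.2 rule (1)] -/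
theorem aff_orbit_of_constMul_int_sub_zsmul_mem_relations {n : ℕ} (R : KZ.IntegralRep n) (k : ℤ) :
    KZ.of (R.constMul (k : ℝ) (isAlgebraic_int k)) - k • KZ.of R ∈ KZ.relations := by
  cases k with
  | ofNat j =>
    have h1 : KZ.of (R.constMul (j : ℝ) (isAlgebraic_nat j)) - j • KZ.of R ∈ KZ.relations :=
      R.of_constMul_nat_sub_nsmul_mem_relations j
    have h2 : KZ.of (R.constMul ((Int.ofNat j : ℤ) : ℝ) (isAlgebraic_int _)) -
        KZ.of (R.constMul (j : ℝ) (isAlgebraic_nat j)) ∈ KZ.relations :=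
      KZ.of_sub_of_mem_relations_of_eqOn rfl fun x _ => by simp
    have : KZ.of (R.constMul ((Int.ofNat j : ℤ) : ℝ) (isAlgebraic_int _)) - (Int.ofNat j) • KZ.of R =
        (KZ.of (R.constMul ((Int.ofNat j : ℤ) : ℝ) (isAlgebraic_int _)) -
          KZ.of (R.constMul (j : ℝ) (isAlgebraic_nat j))) +
        (KZ.of (R.constMul (j : ℝ) (isAlgebraic_nat j)) - j • KZ.of R) := by
      simp only [Int.ofNat_eq_natCast, natCast_zsmul]
      abel
    rw [this]
    exact add_mem h2 h1
  | negSucc j =>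
    have h1 : KZ.of (R.constMul ((j + 1 : ℕ) : ℝ) (isAlgebraic_nat (j + 1))) - (j + 1) • KZ.of R ∈
        KZ.relations := R.of_constMul_nat_sub_nsmul_mem_relations (j + 1)
    have h2 : KZ.of (R.constMul ((Int.negSucc j : ℤ) : ℝ) (isAlgebraic_int _)) +
        KZ.of (R.constMul ((j + 1 : ℕ) : ℝ) (isAlgebraic_nat (j + 1))) ∈ KZ.relations :=
      KZ.of_add_of_mem_relations_of_eqOn_neg rfl fun x _ => by
        simp only [KZ.IntegralRep.integrand_constMul, Pi.neg_apply, Int.cast_negSucc, Nat.cast_add,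
          Nat.cast_one]
        ring
    have : KZ.of (R.constMul ((Int.negSucc j : ℤ) : ℝ) (isAlgebraic_int _)) -
        (Int.negSucc j) • KZ.of R =
        (KZ.of (R.constMul ((Int.negSucc j : ℤ) : ℝ) (isAlgebraic_int _)) +
          KZ.of (R.constMul ((j + 1 : ℕ) : ℝ) (isAlgebraic_nat (j + 1)))) -
        (KZ.of (R.constMul ((j + 1 : ℕ) : ℝ) (isAlgebraic_nat (j + 1))) - (j + 1) • KZ.of R) := by
      rw [negSucc_zsmul]
      abel
    rw [this]
    exact sub_mem h2 h1

/-- **`ℤ`-combinations on a common domain collapse** (iterated rule (1b)): if the `Rᵢ` (`i ∈ s`)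
have the domain of `T` and `T.integrand = Σᵢ mᵢ · Rᵢ.integrand` on it (`mᵢ ∈ ℤ`), then
`[T] − Σᵢ mᵢ • [Rᵢ] ∈ relations`. [cite: KontsevichZagier2001, §1.2 rule (1)] -/
theorem aff_orbit_of_sub_sum_zsmul_mem_relations {n : ℕ} {ι : Type*} (s : Finset ι)
    (R : ι → KZ.IntegralRep n) (m : ι → ℤ) (T : KZ.IntegralRep n)
    (hd : ∀ i ∈ s, (R i).domain = T.domain)
    (h : EqOn T.integrand (fun x => ∑ i ∈ s, (m i : ℝ) * (R i).integrand x) T.domain) :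
    KZ.of T - ∑ i ∈ s, m i • KZ.of (R i) ∈ KZ.relations := by
  have h1 : KZ.of T - ∑ i ∈ s, KZ.of ((R i).constMul (m i : ℝ) (isAlgebraic_int (m i))) ∈
      KZ.relations :=
    KZ.of_sub_sum_integrand_mem_relations s
      (fun i => (R i).constMul (m i : ℝ) (isAlgebraic_int (m i))) T
      (fun i hi => (KZ.IntegralRep.domain_constMul _ _ _).trans (hd i hi))
      fun x hx => by simpa using h hx
  have h2 : ∑ i ∈ s, KZ.of ((R i).constMul (m i : ℝ) (isAlgebraic_int (m i))) -
      ∑ i ∈ s, m i • KZ.of (R i) ∈ KZ.relations :=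
    KZ.sum_sub_sum_mem_relations s _ _ fun i _ =>
      aff_orbit_of_constMul_int_sub_zsmul_mem_relations (R i) (m i)
  have : KZ.of T - ∑ i ∈ s, m i • KZ.of (R i) =
      (KZ.of T - ∑ i ∈ s, KZ.of ((R i).constMul (m i : ℝ) (isAlgebraic_int (m i)))) +
      (∑ i ∈ s, KZ.of ((R i).constMul (m i : ℝ) (isAlgebraic_int (m i))) -
        ∑ i ∈ s, m i • KZ.of (R i)) := by
    abel
  rw [this]
  exact add_mem h1 h2

/-! ### The affine change of variables `x ↦ A x + b` (rule (2)) -/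

/-- The affine map `x ↦ A x + b` with real-algebraic `A`, `b` is a `ℚ`-semialgebraic map on every
`ℚ`-semialgebraic set: its coordinates `x ↦ Σₗ A j l · x l + b j` are real-affine with real-algebraic
(hence `ℚ`-definable) coefficients. [cite: BochnakCosteRoy1998, Prop. 2.2.6] -/
theorem aff_orbit_isSemialgebraicMapOn {d : ℕ} {A : Matrix (Fin d) (Fin d) ℝ} {b : Fin d → ℝ}
    (hA : ∀ j l, IsAlgebraic ℚ (A j l)) (hb : ∀ j, IsAlgebraic ℚ (b j)) {σ : Set (Fin d → ℝ)}
    (hσ : Literature.ModelTheory.ExponentialFields.IsSemialgebraic ℚ σ) :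
    IsSemialgebraicMapOn ℚ σ (fun x => A.mulVec x + b) := by
  have hcoord : ∀ l : Fin d, IsSemialgebraicFunOn ℚ σ (fun x => x l) := fun l => by
    simpa using isSemialgebraicFunOn_aeval hσ (MvPolynomial.X l : MvPolynomial (Fin d) ℚ)
  refine IsSemialgebraicMapOn.of_forall hσ fun j => ?_
  have hsum : IsSemialgebraicFunOn ℚ σ (fun x => ∑ l, A j l * x l) :=
    KZ.isSemialgebraicFunOn_finset_sum Finset.univ hσ fun l _ =>
      (IsSemialgebraicFunOn.mul_holds (isSemialgebraicFunOn_const_of_isAlgebraic hσ (hA j l))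
        (hcoord l)).congr fun x _ => rfl
  exact (IsSemialgebraicFunOn.add_holds hsum
    (isSemialgebraicFunOn_const_of_isAlgebraic hσ (hb j))).congr fun x _ => by
      simp [Matrix.mulVec, dotProduct]

/-- The affine map `x ↦ A x + b` with `det A ≠ 0` is injective. [folklore] -/
theorem aff_orbit_injective {d : ℕ} {A : Matrix (Fin d) (Fin d) ℝ} (b : Fin d → ℝ)
    (hdet : A.det ≠ 0) : Function.Injective (fun x => A.mulVec x + b) := by
  have hU : IsUnit A := (Matrix.isUnit_iff_isUnit_det A).mpr (isUnit_iff_ne_zero.mpr hdet)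
  intro x y hxy
  exact Matrix.mulVec_injective_iff_isUnit.mpr hU (add_right_cancel hxy)

/-- The Jacobian constant `|det A|` of a matrix with real-algebraic entries is real-algebraic
(`det` is an integer polynomial in the entries). [folklore] -/
theorem aff_orbit_isAlgebraic_abs_det {d : ℕ} {A : Matrix (Fin d) (Fin d) ℝ}
    (hA : ∀ j l, IsAlgebraic ℚ (A j l)) : IsAlgebraic ℚ |A.det| := by
  have hdet : IsIntegral ℚ A.det :=
    IsIntegral.det fun j l => isAlgebraic_iff_isIntegral.mp (hA j l)
  rcases abs_choice A.det with h | h <;> rw [h]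
  · exact isAlgebraic_iff_isIntegral.mpr hdet
  · exact isAlgebraic_iff_isIntegral.mpr hdet.neg

/-- **The affine move** (Kontsevich–Zagier's rule (2) along `Φ x = A x + b`). For real-algebraic
`A`, `b` with `det A ≠ 0` and representations `S`, `R` of dimension `d` with `R.domain = Φ '' S.domain`
and `S.integrand x = R.integrand (Φ x) · |det A|` on `S.domain`, the difference `[S] − [R]` is an
element of `KZ.changeOfVariablesRel`: the witness is `Φ` with the constant derivative
`L = toLin' A`, `|det L| = |det A|`. [cite: KontsevichZagier2001, §1.2 rule (2)] -/
theorem aff_orbit_of_sub_of_mem_changeOfVariablesRel {d : ℕ} (A : Matrix (Fin d) (Fin d) ℝ)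
    (b : Fin d → ℝ) (hA : ∀ j l, IsAlgebraic ℚ (A j l)) (hb : ∀ j, IsAlgebraic ℚ (b j))
    (hdet : A.det ≠ 0) (S R : KZ.IntegralRep d)
    (hdom : R.domain = (fun x => A.mulVec x + b) '' S.domain)
    (hint : ∀ x ∈ S.domain, S.integrand x = R.integrand (A.mulVec x + b) * |A.det|) :
    KZ.of S - KZ.of R ∈ KZ.changeOfVariablesRel := by
  set L : (Fin d → ℝ) →L[ℝ] (Fin d → ℝ) := LinearMap.toContinuousLinearMap (Matrix.toLin' A)
    with hL
  have hLapply : ∀ x, L x = A.mulVec x := fun x => by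
    rw [hL, LinearMap.coe_toContinuousLinearMap', Matrix.toLin'_apply]
  have hLdet : L.det = A.det := by
    rw [hL, LinearMap.det_toContinuousLinearMap, LinearMap.det_toLin']
  have hderiv : ∀ x, HasFDerivAt (fun x => A.mulVec x + b) L x := fun x => by
    have heq : (fun x => A.mulVec x + b) = fun x => L x + b := funext fun x => by rw [hLapply]
    rw [heq]
    exact L.hasFDerivAt.add_const b
  refine ⟨d, S, R, fun x => A.mulVec x + b, fun _ => L,
    aff_orbit_isSemialgebraicMapOn hA hb S.isSemialgebraic_domain,
    fun x _ => (hderiv x).hasFDerivWithinAt, (aff_orbit_injective b hdet).injOn, hdom,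
    fun x hx => ?_, rfl⟩
  rw [hint x hx, hLdet]

/-! ### The stub -/

/-- STUB `stub_affineOrbit` (THE EUCLIDEAN AFFINE SECTOR CLOSES OUTRIGHT, every dimension): a
`ℤ`-linear relation among the volumes of real-algebraic affine images `Aᵢ B + bᵢ` (`det Aᵢ ≠ 0`) of
one `ℚ`-semialgebraic body `B` of finite volume is a KZ relation among the integrand-`1`
representations on them: each is ONE change of variables away from `[B, |det Aᵢ|]` (rule (2),
constant Jacobian), and constant integrands on a common domain add (rule (1b)).
Instances: `ℚ̄`-simplices (Hilbert's third problem: the Dehn invariant is invisible), boxes,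
ellipsoids. [cite: KontsevichZagier2001, §1.2 rules (1), (2)] -/
theorem stub_affineOrbit (d k : ℕ) (B : Set (Fin d → ℝ)) (A : Fin k → Matrix (Fin d) (Fin d) ℝ)
    (b : Fin k → Fin d → ℝ) (m : Fin k → ℤ) (r : Fin k → KZ.IntegralRep d)
    (hB : Literature.ModelTheory.ExponentialFields.IsSemialgebraic ℚ B) (hBvol : volume B ≠ ⊤)
    (hA : ∀ i j l, IsAlgebraic ℚ (A i j l)) (hb : ∀ i j, IsAlgebraic ℚ (b i j)) (hdet : ∀ i, (A i).det ≠ 0)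
    (hdom : ∀ i, (r i).domain = (fun x => (A i).mulVec x + b i) '' B)
    (hone : ∀ i, ∀ x ∈ (r i).domain, (r i).integrand x = 1)
    (hsum : ∑ i, (m i : ℝ) * (r i).value = 0) : ∑ i, m i • KZ.of (r i) ∈ KZ.relations := by
  -- the representation `O = [B, 1]`
  obtain ⟨O, hOd, hOi⟩ := KZ.exists_oneRep hB hBvol
  subst hOd
  -- the Jacobian constants `cᵢ = |det Aᵢ|` are real-algebraic
  have halg : ∀ i, IsAlgebraic ℚ |(A i).det| := fun i => aff_orbit_isAlgebraic_abs_det (hA i)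
  -- the reference representations `Sᵢ = [B, cᵢ]` on the common domain `B`
  obtain ⟨S, hSd, hSi, hSv⟩ : ∃ S : Fin k → KZ.IntegralRep d, (∀ i, (S i).domain = O.domain) ∧
      (∀ i, (S i).integrand = fun x => |(A i).det| * O.integrand x) ∧
      (∀ i, (S i).value = |(A i).det| * O.value) :=
    ⟨fun i => O.constMul |(A i).det| (halg i), fun _ => rfl, fun _ => rfl,
      fun i => KZ.IntegralRep.value_constMul _ _ _⟩
  -- rule (2): `[Sᵢ] − [rᵢ] ∈ relations`
  have hmove : ∀ i, KZ.of (S i) - KZ.of (r i) ∈ KZ.relations := fun i => by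
    refine KZ.changeOfVariablesRel_subset_relations
      (aff_orbit_of_sub_of_mem_changeOfVariablesRel (A i) (b i) (hA i) (hb i) (hdet i) (S i) (r i)
        (by rw [hSd]; exact hdom i) fun x hx => ?_)
    have hx' : (A i).mulVec x + b i ∈ (r i).domain := by
      rw [hdom i]
      exact mem_image_of_mem _ (by rw [← hSd i]; exact hx)
    simp only [hone i _ hx', hSi, hOi]
    ring
  -- soundness: `value rᵢ = cᵢ · value O`
  have hval : ∀ i, (r i).value = |(A i).det| * O.value := fun i =>
    (KZ.Equivalent.value_eq_holds (hmove i)).symm.trans (hSv i)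
  -- the hypothesis reads `(Σ mᵢ cᵢ) · value O = 0`
  have hprod : (∑ i, (m i : ℝ) * |(A i).det|) * O.value = 0 := by
    rw [← hsum, Finset.sum_mul]
    exact Finset.sum_congr rfl fun i _ => by rw [hval i]; ring
  -- the collapsed representation `T = [B, Σ mᵢ cᵢ]`
  have hcalg : IsAlgebraic ℚ (∑ i, (m i : ℝ) * |(A i).det|) :=
    isAlgebraic_iff_isIntegral.mpr (IsIntegral.sum _ fun i _ =>
      (isAlgebraic_iff_isIntegral.mp (isAlgebraic_int (m i))).mul
        (isAlgebraic_iff_isIntegral.mp (halg i)))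
  obtain ⟨T, hTd, hTi⟩ : ∃ T : KZ.IntegralRep d, T.domain = O.domain ∧
      T.integrand = fun x => (∑ i, (m i : ℝ) * |(A i).det|) * O.integrand x :=
    ⟨O.constMul _ hcalg, rfl, rfl⟩
  -- `[T]` is a relation: null domain or zero integrand
  have hT : KZ.of T ∈ KZ.relations := by
    by_cases hO : O.value = 0
    · have hvol : volume O.domain = 0 := by
        rw [O.value_eq_volume_real (fun x _ => by rw [hOi]), measureReal_def,
          ENNReal.toReal_eq_zero_iff] at hO
        exact hO.resolve_right hBvol
      exact KZ.of_mem_relations_of_volume_eq_zero T (by rw [hTd]; exact hvol)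
    · have h0 : ∑ i, (m i : ℝ) * |(A i).det| = 0 := (mul_eq_zero.mp hprod).resolve_right hO
      exact KZ.of_mem_relations_of_eqOn_zero T fun x _ => by simp [hTi, h0]
  -- rule (1b), iterated: `[T] − Σ mᵢ • [Sᵢ] ∈ relations`
  have hTS : KZ.of T - ∑ i, m i • KZ.of (S i) ∈ KZ.relations :=
    aff_orbit_of_sub_sum_zsmul_mem_relations Finset.univ S m T (fun i _ => by rw [hSd, hTd])
      fun x _ => by
        simp only [hTi, hSi]
        rw [Finset.sum_mul]
        exact Finset.sum_congr rfl fun i _ => by ring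
  -- termwise: `Σ mᵢ • [Sᵢ] − Σ mᵢ • [rᵢ] ∈ relations`
  have hSr : ∑ i, m i • KZ.of (S i) - ∑ i, m i • KZ.of (r i) ∈ KZ.relations :=
    KZ.sum_sub_sum_mem_relations _ _ _ fun i _ => by
      rw [← smul_sub]
      exact zsmul_mem (hmove i) _
  -- bookkeeping in the free abelian group
  have key : ∑ i, m i • KZ.of (r i) = KZ.of T - (KZ.of T - ∑ i, m i • KZ.of (S i)) -
      (∑ i, m i • KZ.of (S i) - ∑ i, m i • KZ.of (r i)) := by
    abel
  rw [key]
  exact sub_mem (sub_mem hT hTS) hSr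

end Summit.KontsevichZagierPeriods.HyperbolicBloch.OffTetraSectorKernel

end
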